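import Summits.BirchSwinnertonDyer.BirchSwinnertonDyer.Theorems.ByReductionTypeAtTwoSupersingularConjATwoGoodSSGenusDoor
import Summits.BirchSwinnertonDyer.BirchSwinnertonDyer.Theorems.ByReductionTypeAtTwoSupersingularConjATwoGoodSSUnitSignatureCertificates
import Summits.BirchSwinnertonDyer.BirchSwinnertonDyer.Theorems.ByReductionTypeAtTwoSupersingularConjATwoGoodSSRowKernelStamps
import HarnessLib

/-!
# Route `ByReductionTypeAtTwo` (rung K4), crux `SupersingularRankZeroAtTwo` (item stmt-BirchSwinnertonDyer-19097), registry v2.12 stub 3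
# `stub_fineMu : FineMuZeroOnHabitatAtTwo`: THE FOUR TOTALLY REAL ROWS `37b1`, `141e1`, `189c1`, `189d1` (`Δ_E > 0`) RE-KEYED
# THROUGH THE SIGNATURE GENUS DOOR — (A)₂ / `FineMuZeroAt (M ⊗ ℚ) 2` UNCONDITIONAL (no `hLim2`, no displayed bit)
# (a `--supports 19097` file; seat `bsd-2adic-t42` GEN 44, task T-85 «THE NARROW DOOR RE-KEY» of director-bsd (825)(ii) / `-imc` g33 D-imc-85;
# sequel of `…GoodSSGenusDoor` + `…GoodSSUnitSignatureCertificates`, re-keying GEN 43's `…GoodSSRowKernelStamps`)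

HONEST LABEL (cell `bsd-2adic`, D-0036/D-0054): THEOREMS ONLY (no definition, no named fact, no `sorry`). `conjA_two_<label>'` /
`fineMuZeroAt_two_<label>'` are PROVED OUTRIGHT — Coates–Sujatha's statement (A) at `p = 2` for these FOUR curves with no hypothesis and
no named fact (GEN 43's `conjA_two_<label> hLim2` consumed Lim 2017 Thm. 3.5 at `2` at a TOTALLY REAL cubic carrier, outside that fact's
page-verified scope — the D-imc-85 scope pass; these primed versions need no Lim fact at all). Statement (A) is NOT BSD; stub 3
(class-wide) is NOT discharged; 19097 OPEN; nothing booked; BSD is proved for no curve.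

MECHANISM (all kernel). For each row the `2`-torsion point field `L_W = ℚ(β) = ℚ(θ)` (GEN 43's generator swap `θ = u(β)`, `β = v(θ)`,
copied verbatim from `…KernelStamps`) is the TOTALLY REAL cubic field of the `polredabs` cubic `g` (`d = 148`: `X³ − X² − 3X + 1`; `564`:
`X³ − X² − 5X + 3`; `756`: `X³ − 6X − 2`), with `h` odd BY THE KERNEL (GEN 43 `…FieldCertificatesA/B`), ONE prime above `2` (`π = β/2`
Eisenstein, `…GoodSSGenusDoor` §1) and units of ALL signatures (`…GoodSSUnitSignatureCertificates`); the signature genus door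
`conjA_two_goodSSModel_of_generator_of_signVec_surjective` (Chevalley WITH SIGNATURES on `ℚ(θ, √−1)/ℚ(θ)`, p724470; one prime above `2` in
the sextic, p722472; Iwasawa 1956; cruxlead-19573-w2's door p718233) gives (A)₂ — NO Lim 2017 fact, NO Ferrero–Washington.

References: [CoatesSujatha2005] Conj. A, Thm. 3.4; [Greenberg2001IwasawaPastPresent] Prop. 2.1; [FrohlichTaylor1990] Ch. V §1 (1.12);
Cremona `ecdata` (minimal models); tree p718233, p722472, p724470, GEN 43 ★ p822499/p823030.
-/
set_option autoImplicit false
-- sibling precedent (`…GoodSSGenusDoor.lean`): the directory name repeats the summit name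
set_option linter.dupNamespace false

noncomputable section

open scoped Classical IntermediateField NumberField

namespace Summit.BirchSwinnertonDyer.BirchSwinnertonDyer.Theorems.AddKatoTwo

open WeierstrassCurve Field Polynomial IsDedekindDomain NumberField Literature.NumberTheory.EllipticCurves
  Literature.NumberTheory.GaloisRepresentations Literature.NumberTheory.IwasawaTheory Literature.NumberTheory.NumberFields
  Literature.Geometry.Kaehler.ComplexTorus
  Summit.BirchSwinnertonDyer.BirchSwinnertonDyer.Theorems.AlignedTransportAtTwoTorsionPointField
  Summit.BirchSwinnertonDyer.BirchSwinnertonDyer.Theses.ByReductionTypeAtTwo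

/-! ## §2 The four totally real rows, UNCONDITIONAL -/

section Rows

/-! ### Row `37b1` = `[0, 1, 1, -23, -50]` (`N = 37`; `L_W`: `X³ − X² − 3X + 1`, `d = 148`, totally real, `h = 1`) -/

/-- **UNCONDITIONAL (A)₂ for `37b1` — ZERO hypotheses, ZERO named facts.** Coates–Sujatha's statement (A) at `p = 2` for the Cremona
minimal model `[0, 1, 1, -23, -50]` (`∃ γ D`, `D.X` finitely generated over `ℤ₂`, for every cyclotomic `ℤ₂`-extension of `ℚ`). KERNEL
throughout: generator swap `θ = (-315/37) + (-21/74)·β + (5/148)·β²` / `β = (20) + (6)·θ + (-10)·θ²` (GEN 43, verbatim),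
`ℚ(P) = ℚ(β) = ℚ(θ)` the TOTALLY REAL cubic field of `X³ − X² − 3X + 1` (`d = 148`): `h` odd (`not_two_dvd_card_classGroup_twoDivField_d148p`),
one prime above `2` (`π = β/2` Eisenstein), units of all signatures (`signVec_surjective_cubicField_d148p`); the signature genus door
`conjA_two_goodSSModel_of_generator_of_signVec_surjective`. UPGRADES `conjA_two_37b1 hLim2` (GEN 43: Lim 2017 at a totally real carrier,
outside the fact's page-verified scope). BSD for `37b1` is NOT proved by this. [cite: CoatesSujatha2005, Conj. A and Thm. 3.4]
[cite: Greenberg2001IwasawaPastPresent, Prop. 2.1 p. 339] [cite: FrohlichTaylor1990, Ch. V §1 (1.12), p. 164] -/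
theorem conjA_two_37b1' (κ : ZpExtension ℚ 2) (hκ : κ.IsCyclotomic) :
    haveI := isElliptic_37b1
    ∃ (γ : absoluteGaloisGroup ℚ) (D : ((⟨0, 1, 1, -23, -50⟩ : WeierstrassCurve ℤ).baseChange ℚ).FineSelmerDualData κ γ),
      Module.Finite ℤ_[2] (RestrictScalars ℤ_[2] (IwasawaAlgebra 2) D.X) := by
  haveI := isElliptic_37b1
  refine conjA_two_goodSSModel_of_generator_of_signVec_surjective (1) (-23) (-50) (-1) (-3) (1) (-315/37) (-21/74) (5/148) (20) (6) (-10)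
    (fun β θ hβ hθ ↦ ?_) (fun θ hθ _ ↦ signVec_surjective_cubicField_d148p hθ)
    (fun θ hθ ↦ not_two_dvd_card_classGroup_twoDivField_d148p hθ) κ hκ
  subst hθ; push_cast at hβ ⊢
  exact ⟨by linear_combination (((84379 : AlgebraicClosure ℚ) / 405224) + ((-2785 : AlgebraicClosure ℚ) / 810448) * β + ((-1825 : AlgebraicClosure ℚ) / 1620896) * β ^ 2 + ((125 : AlgebraicClosure ℚ) / 3241792) * β ^ 3) * hβ,
    by linear_combination (-1 : AlgebraicClosure ℚ) * (((325 : AlgebraicClosure ℚ) / 1369) + ((-125 : AlgebraicClosure ℚ) / 10952) * β) * hβ⟩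

/-- **`FineMuZeroAt (37b1 ⊗ ℚ) 2` UNCONDITIONALLY** — the registry's stub-3 currency `Rank1Residual.FineMuZeroAt (M ⊗ ℚ) 2` for this row with
NO hypothesis and NO named fact (upgrades `fineMuZeroAt_two_37b1 hLim2`). [cite: CoatesSujatha2005, Conj. A and Thm. 3.4]
[cite: FrohlichTaylor1990, Ch. V §1 (1.12), p. 164] -/
theorem fineMuZeroAt_two_37b1' :
    haveI := isElliptic_37b1
    Literature.NumberTheory.EllipticCurves.Rank1Residual.FineMuZeroAt ((⟨0, 1, 1, -23, -50⟩ : WeierstrassCurve ℤ).baseChange ℚ) 2 :=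
  haveI := isElliptic_37b1
  Literature.NumberTheory.EllipticCurves.Rank1Residual.ConjAAt.fineMuZeroAt conjA_two_37b1'

/-! ### Row `141e1` = `[0, 1, 1, -26, -61]` (`N = 141`; `L_W`: `X³ − X² − 5X + 3`, `d = 564`, totally real, `h = 1`) -/

/-- **UNCONDITIONAL (A)₂ for `141e1` — ZERO hypotheses, ZERO named facts.** Coates–Sujatha's statement (A) at `p = 2` for the Cremona
minimal model `[0, 1, 1, -26, -61]` (`∃ γ D`, `D.X` finitely generated over `ℤ₂`, for every cyclotomic `ℤ₂`-extension of `ℚ`). KERNEL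
throughout: generator swap `θ = (-147) + (-9/2)·β + (1/2)·β²` / `β = (-18) + (6)·θ + (4)·θ²` (GEN 43, verbatim),
`ℚ(P) = ℚ(β) = ℚ(θ)` the TOTALLY REAL cubic field of `X³ − X² − 5X + 3` (`d = 564`): `h` odd (`not_two_dvd_card_classGroup_twoDivField_d564p`),
one prime above `2` (`π = β/2` Eisenstein), units of all signatures (`signVec_surjective_cubicField_d564p`); the signature genus door
`conjA_two_goodSSModel_of_generator_of_signVec_surjective`. UPGRADES `conjA_two_141e1 hLim2` (GEN 43: Lim 2017 at a totally real carrier,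
outside the fact's page-verified scope). BSD for `141e1` is NOT proved by this. [cite: CoatesSujatha2005, Conj. A and Thm. 3.4]
[cite: Greenberg2001IwasawaPastPresent, Prop. 2.1 p. 339] [cite: FrohlichTaylor1990, Ch. V §1 (1.12), p. 164] -/
theorem conjA_two_141e1' (κ : ZpExtension ℚ 2) (hκ : κ.IsCyclotomic) :
    haveI := isElliptic_141e1
    ∃ (γ : absoluteGaloisGroup ℚ) (D : ((⟨0, 1, 1, -26, -61⟩ : WeierstrassCurve ℤ).baseChange ℚ).FineSelmerDualData κ γ),
      Module.Finite ℤ_[2] (RestrictScalars ℤ_[2] (IwasawaAlgebra 2) D.X) := by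
  haveI := isElliptic_141e1
  refine conjA_two_goodSSModel_of_generator_of_signVec_surjective (1) (-26) (-61) (-1) (-5) (3) (-147) (-9/2) (1/2) (-18) (6) (4)
    (fun β θ hβ hθ ↦ ?_) (fun θ hθ _ ↦ signVec_surjective_cubicField_d564p hθ)
    (fun θ hθ ↦ not_two_dvd_card_classGroup_twoDivField_d564p hθ) κ hκ
  subst hθ; push_cast at hβ ⊢
  exact ⟨by linear_combination (((6579 : AlgebraicClosure ℚ) / 8) + ((-101 : AlgebraicClosure ℚ) / 8) * β + ((-31 : AlgebraicClosure ℚ) / 8) * β ^ 2 + ((1 : AlgebraicClosure ℚ) / 8) * β ^ 3) * hβ,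
    by linear_combination (-1 : AlgebraicClosure ℚ) * ((-22 : AlgebraicClosure ℚ) + (1 : AlgebraicClosure ℚ) * β) * hβ⟩

/-- **`FineMuZeroAt (141e1 ⊗ ℚ) 2` UNCONDITIONALLY** — the registry's stub-3 currency `Rank1Residual.FineMuZeroAt (M ⊗ ℚ) 2` for this row with
NO hypothesis and NO named fact (upgrades `fineMuZeroAt_two_141e1 hLim2`). [cite: CoatesSujatha2005, Conj. A and Thm. 3.4]
[cite: FrohlichTaylor1990, Ch. V §1 (1.12), p. 164] -/
theorem fineMuZeroAt_two_141e1' :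
    haveI := isElliptic_141e1
    Literature.NumberTheory.EllipticCurves.Rank1Residual.FineMuZeroAt ((⟨0, 1, 1, -26, -61⟩ : WeierstrassCurve ℤ).baseChange ℚ) 2 :=
  haveI := isElliptic_141e1
  Literature.NumberTheory.EllipticCurves.Rank1Residual.ConjAAt.fineMuZeroAt conjA_two_141e1'

/-! ### Row `189c1` = `[0, 0, 1, -6, 3]` (`N = 189`; `L_W`: `X³ − 6X − 2`, `d = 756`, totally real, `h = 1`) -/

/-- **UNCONDITIONAL (A)₂ for `189c1` — ZERO hypotheses, ZERO named facts.** Coates–Sujatha's statement (A) at `p = 2` for the Cremona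
minimal model `[0, 0, 1, -6, 3]` (`∃ γ D`, `D.X` finitely generated over `ℤ₂`, for every cyclotomic `ℤ₂`-extension of `ℚ`). KERNEL
throughout: generator swap `θ = (-16/7) + (-1/14)·β + (1/28)·β²` / `β = (8) + (-2)·θ + (-2)·θ²` (GEN 43, verbatim),
`ℚ(P) = ℚ(β) = ℚ(θ)` the TOTALLY REAL cubic field of `X³ − 6X − 2` (`d = 756`): `h` odd (`not_two_dvd_card_classGroup_twoDivField_d756p`),
one prime above `2` (`π = β/2` Eisenstein), units of all signatures (`signVec_surjective_cubicField_d756p`); the signature genus door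
`conjA_two_goodSSModel_of_generator_of_signVec_surjective`. UPGRADES `conjA_two_189c1 hLim2` (GEN 43: Lim 2017 at a totally real carrier,
outside the fact's page-verified scope). BSD for `189c1` is NOT proved by this. [cite: CoatesSujatha2005, Conj. A and Thm. 3.4]
[cite: Greenberg2001IwasawaPastPresent, Prop. 2.1 p. 339] [cite: FrohlichTaylor1990, Ch. V §1 (1.12), p. 164] -/
theorem conjA_two_189c1' (κ : ZpExtension ℚ 2) (hκ : κ.IsCyclotomic) :
    haveI := isElliptic_189c1
    ∃ (γ : absoluteGaloisGroup ℚ) (D : ((⟨0, 0, 1, -6, 3⟩ : WeierstrassCurve ℤ).baseChange ℚ).FineSelmerDualData κ γ),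
      Module.Finite ℤ_[2] (RestrictScalars ℤ_[2] (IwasawaAlgebra 2) D.X) := by
  haveI := isElliptic_189c1
  refine conjA_two_goodSSModel_of_generator_of_signVec_surjective (0) (-6) (3) (0) (-6) (-2) (-16/7) (-1/14) (1/28) (8) (-2) (-2)
    (fun β θ hβ hθ ↦ ?_) (fun θ hθ _ ↦ signVec_surjective_cubicField_d756p hθ)
    (fun θ hθ ↦ not_two_dvd_card_classGroup_twoDivField_d756p hθ) κ hκ
  subst hθ; push_cast at hβ ⊢
  exact ⟨by linear_combination (((-3 : AlgebraicClosure ℚ) / 2744) + ((-3 : AlgebraicClosure ℚ) / 784) * β + ((-3 : AlgebraicClosure ℚ) / 10976) * β ^ 2 + ((1 : AlgebraicClosure ℚ) / 21952) * β ^ 3) * hβ,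
    by linear_combination (-1 : AlgebraicClosure ℚ) * (((1 : AlgebraicClosure ℚ) / 98) + ((-1 : AlgebraicClosure ℚ) / 392) * β) * hβ⟩

/-- **`FineMuZeroAt (189c1 ⊗ ℚ) 2` UNCONDITIONALLY** — the registry's stub-3 currency `Rank1Residual.FineMuZeroAt (M ⊗ ℚ) 2` for this row with
NO hypothesis and NO named fact (upgrades `fineMuZeroAt_two_189c1 hLim2`). [cite: CoatesSujatha2005, Conj. A and Thm. 3.4]
[cite: FrohlichTaylor1990, Ch. V §1 (1.12), p. 164] -/
theorem fineMuZeroAt_two_189c1' :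
    haveI := isElliptic_189c1
    Literature.NumberTheory.EllipticCurves.Rank1Residual.FineMuZeroAt ((⟨0, 0, 1, -6, 3⟩ : WeierstrassCurve ℤ).baseChange ℚ) 2 :=
  haveI := isElliptic_189c1
  Literature.NumberTheory.EllipticCurves.Rank1Residual.ConjAAt.fineMuZeroAt conjA_two_189c1'

/-! ### Row `189d1` = `[0, 0, 1, -27, -7]` (`N = 189`; `L_W`: `X³ − 6X − 2`, `d = 756`, totally real, `h = 1`) -/

/-- **UNCONDITIONAL (A)₂ for `189d1` — ZERO hypotheses, ZERO named facts.** Coates–Sujatha's statement (A) at `p = 2` for the Cremona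
minimal model `[0, 0, 1, -27, -7]` (`∃ γ D`, `D.X` finitely generated over `ℤ₂`, for every cyclotomic `ℤ₂`-extension of `ℚ`). KERNEL
throughout: generator swap `θ = (8/3) + (1/18)·β + (-1/108)·β²` / `β = (24) + (6)·θ + (-6)·θ²` (GEN 43, verbatim),
`ℚ(P) = ℚ(β) = ℚ(θ)` the TOTALLY REAL cubic field of `X³ − 6X − 2` (`d = 756`): `h` odd (`not_two_dvd_card_classGroup_twoDivField_d756p`),
one prime above `2` (`π = β/2` Eisenstein), units of all signatures (`signVec_surjective_cubicField_d756p`); the signature genus door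
`conjA_two_goodSSModel_of_generator_of_signVec_surjective`. UPGRADES `conjA_two_189d1 hLim2` (GEN 43: Lim 2017 at a totally real carrier,
outside the fact's page-verified scope). BSD for `189d1` is NOT proved by this. [cite: CoatesSujatha2005, Conj. A and Thm. 3.4]
[cite: Greenberg2001IwasawaPastPresent, Prop. 2.1 p. 339] [cite: FrohlichTaylor1990, Ch. V §1 (1.12), p. 164] -/
theorem conjA_two_189d1' (κ : ZpExtension ℚ 2) (hκ : κ.IsCyclotomic) :
    haveI := SSUnitAnchor.isElliptic_ua189d1
    ∃ (γ : absoluteGaloisGroup ℚ) (D : ((⟨0, 0, 1, -27, -7⟩ : WeierstrassCurve ℤ).baseChange ℚ).FineSelmerDualData κ γ),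
      Module.Finite ℤ_[2] (RestrictScalars ℤ_[2] (IwasawaAlgebra 2) D.X) := by
  haveI := SSUnitAnchor.isElliptic_ua189d1
  refine conjA_two_goodSSModel_of_generator_of_signVec_surjective (0) (-27) (-7) (0) (-6) (-2) (8/3) (1/18) (-1/108) (24) (6) (-6)
    (fun β θ hβ hθ ↦ ?_) (fun θ hθ _ ↦ signVec_surjective_cubicField_d756p hθ)
    (fun θ hθ ↦ not_two_dvd_card_classGroup_twoDivField_d756p hθ) κ hκ
  subst hθ; push_cast at hβ ⊢
  exact ⟨by linear_combination (((-13 : AlgebraicClosure ℚ) / 5832) + ((1 : AlgebraicClosure ℚ) / 3888) * β + ((1 : AlgebraicClosure ℚ) / 69984) * β ^ 2 + ((-1 : AlgebraicClosure ℚ) / 1259712) * β ^ 3) * hβ,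
    by linear_combination (-1 : AlgebraicClosure ℚ) * (((1 : AlgebraicClosure ℚ) / 162) + ((-1 : AlgebraicClosure ℚ) / 1944) * β) * hβ⟩

/-- **`FineMuZeroAt (189d1 ⊗ ℚ) 2` UNCONDITIONALLY** — the registry's stub-3 currency `Rank1Residual.FineMuZeroAt (M ⊗ ℚ) 2` for this row with
NO hypothesis and NO named fact (upgrades `fineMuZeroAt_two_189d1 hLim2`). [cite: CoatesSujatha2005, Conj. A and Thm. 3.4]
[cite: FrohlichTaylor1990, Ch. V §1 (1.12), p. 164] -/
theorem fineMuZeroAt_two_189d1' :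
    haveI := SSUnitAnchor.isElliptic_ua189d1
    Literature.NumberTheory.EllipticCurves.Rank1Residual.FineMuZeroAt ((⟨0, 0, 1, -27, -7⟩ : WeierstrassCurve ℤ).baseChange ℚ) 2 :=
  haveI := SSUnitAnchor.isElliptic_ua189d1
  Literature.NumberTheory.EllipticCurves.Rank1Residual.ConjAAt.fineMuZeroAt conjA_two_189d1'

end Rows

end Summit.BirchSwinnertonDyer.BirchSwinnertonDyer.Theorems.AddKatoTwo

end

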